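import Summits.HodgeConjecture.HodgeConjecture.Theorems.Ring2WeilCoverageCMFieldCellsNonvacuous
import Literature.AlgebraicGeometry.Pohlmann1968.NondegenerateCMTypeHodgeConjecture
import Literature.NumberTheory.ComplexMultiplication.PrimitiveCMTypeExistenceGalois
import Literature.AlgebraicGeometry.Pohlmann1968.NondegenerateCMTypeExistenceAbelianField
import Literature.AlgebraicGeometry.Pohlmann1968.NonSimpleCMAbelianVarietyHazamaCriterion
import Literature.AlgebraicGeometry.Pohlmann1968.NondegenerateCMTypeDivisorGenerated
import HarnessLib

/-!
# Ring 2 — Weil-type family-coverage census, CM-field rows (X-C): the Hodge conjecture HOLDS at the CM power member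
# of every δ-cell — nondegenerate types (abelian non-`V₄`, cyclic, degree `2ℓ`) and induced types (imaginary
# quadratic subfield): every quartic Galois CM field

HONEST FRAMING: research route conditional on HC_CM; not a corollary; Q11.4-sentence-2 already refuted in dim ≥ 3.

Cell `pub-hodge-ring2`, seat `ring2-b03` (gen 55), census `WEIL-FAMILY-COVERAGE.md` «## b03» (CM fields `[E:ℚ] > 2`),
sequel of parts X-A/X-B (`Ring2WeilCoverageCMFieldCellsInhabited`, `…Nonvacuous`: on EVERY δ-row the CM power member
`B^p × (B^ρ)^p` with a Rosati-compatible polarization class of discriminant `δ`). THEOREMS ONLY: no `def`, no named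
fact, no `sorry`. `HC_CM` (`Theses.RankFourFaces.CMAbelianHodge`) does not occur in this file; the Hodge conjecture is
USED only where the tree PROVES it outright — `Pohlmann1968.IsNondegenerate.hodgeConjectureFor_pow` (Pohlmann 1968 /
Kubota / White: `Hdg = Div` on every power of a realisation of a NONDEGENERATE CM type), with the supply of
nondegenerate types from Yanai (primitive of prime half-degree ⟹ nondegenerate,
`Pohlmann1968.isNondegenerate_of_isPrimitive_of_prime`) and Schappacher (a Galois CM field has a primitive type iff its
group is neither `V₄` nor `D₄`, `PrimitiveCMTypeGalois.exists_isPrimitive`).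

* `exists_cmPower_hodgeConjectureFor_of_isNondegenerate` — `K` Galois CM, `[K:ℚ] > 2`, Deligne's presentation
  `(b₀, R)`, `(B, ι, θ)` realising a NONDEGENERATE type `Ψ`, every `p ≥ 1`, EVERY `δ`: the power `B^{2p}` carries a
  Weil-type `η`, a Rosati-compatible polarization class of discriminant `δ`, `HodgeConjectureFor` HOLDS for it, and ALL
  of `W_E(B^{2p}) ⊗ ℂ` is algebraic — the conclusion of the cell `WeilClassesComponentCM R e₀ p δ` is TRUE at this
  member, for every `δ` (a CM anchor with HC in the kernel on every row; census b03.6 (α)).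
* `exists_cmMember_hodgeConjectureFor_of_finrank_eq_two_mul_prime` — `[K:ℚ] = 2ℓ`, `ℓ` an odd prime (Schappacher
  + Yanai, no commutativity hypothesis).
* `exists_simplePower_hodgeConjectureFor_of_not_isKleinFour` — EVERY ABELIAN Galois CM field with `Gal ≄ V₄` (Schmidt
  Kap. III Satz 2.1 in the tree, `Pohlmann1968.AbelianCMFieldExistence.exists_isNondegenerate`): the member is
  `B^{2p}` with `B` SIMPLE;
  `…_of_isCyclic` — every CYCLIC CM field; `exists_cmEightfold_hodgeConjectureFor_of_isCyclic_four` — the census rows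
  `W8.E.δ` of a cyclic quartic field (`ℚ(ζ₅)`, `ℚ(√-(2+√2))`): a CM eightfold `B⁴`, `B` a simple CM surface, with HC
  (kernel) and `W_E(B⁴) ⊗ ℂ` algebraic, on EVERY row.
* `exists_cmPower_hodgeConjectureFor_of_inducedCMType` — types INDUCED from a nondegenerate type of a CM subfield
  `K₁ ⊆ K` (Hazama's criterion in the tree, `IsNondegenerate.hodgeClassSpan_pow_eq_divisorClassesSpan_inducedCMType`):
  HC at the (non-simple) member `B^{2p}`, `B ~ A₁^{[K:K₁]}`; `exists_cmMember_hodgeConjectureFor_of_quadratic_subfield`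
  — EVERY Galois CM field containing an IMAGINARY QUADRATIC field (`Pohlmann1968.isNondegenerate_of_finrank_eq_two`);
  `exists_cmEightfold_hodgeConjectureFor_of_quadratic_subfield_four` — the rows `W8.E.δ` of the four BIQUADRATIC
  census fields (`ℚ(ζ₈)`, `ℚ(ζ₁₂)`, `ℚ(√-3,√5)`, `ℚ(i,√5)`; census b03.6 (β) in the kernel). With the cyclic case:
  EVERY quartic Galois CM field, i.e. all six Galois census fields, has on EVERY δ-row a CM eightfold at which the
  Hodge conjecture holds in the kernel.

HONEST COLUMN: the `D₄` census field `ℚ(√-(3+√2))` (non-Galois) is NOT covered (`[IsGalois ℚ K]` inherited from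
parts X-A/X-B); no positivity is recorded by `IsPolarizationClass` (every `δ` is reached, including the classes of the
wrong sign at the real places, whose rows are EMPTY for polarized members); nothing is claimed at any member other than
the named CM powers — the GENERAL member of every row stays OPEN (deciding input = transport, crux stmt-1076).

## References
* [Pohlmann1968] H. Pohlmann, *Algebraic cycles on abelian varieties of complex multiplication type*, Ann. of Math. 88
  (1968), Thm. 1. [Kubota1965] T. Kubota, Trans. AMS 118 (1965), §2. [Yanai1985] H. Yanai, Nagoya Math. J. 97 (1985), §4.
  [Hazama1985] F. Hazama, J. Fac. Sci. Univ. Tokyo 31 (1985) (non-simple case, through Gordon Thm. 6.4).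
* [Gordon1999HodgeAVSurvey] B. Gordon, Appendix B to Lewis, *A survey of the Hodge conjecture* (1999), Thm. 6.3.
* [Schmidt1984CMArithmetik] C.-G. Schmidt, *Arithmetik abelscher Varietäten mit komplexer Multiplikation*, LNM 1082
  (1984), Kap. II Satz 1.6 (Schappacher), Kap. III Satz 2.1.
* [Deligne1982HodgeCycles] P. Deligne (notes by J. S. Milne), LNM 900 (1982), §5 (c) pp. 38–39.
-/

noncomputable section

set_option linter.dupNamespace false

namespace Summit.HodgeConjecture.HodgeConjecture.Ring2.WeilCoverageCM

open CategoryTheory CategoryTheory.Limits Polynomial NumberField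
open Literature.AlgebraicTopology.SingularHomology
open Literature.AlgebraicGeometry Literature.AlgebraicGeometry.Motives Literature.AlgebraicGeometry.HodgeTheory
open Literature.AlgebraicGeometry.ComplexMultiplication Literature.AlgebraicGeometry.Deligne1982
open Literature.AlgebraicGeometry.Milne1999
open Literature.AlgebraicGeometry.Pohlmann1968 (IsNondegenerate isNondegenerate_of_isPrimitive_of_prime)
open Literature.NumberTheory.ComplexMultiplication (PrimitiveCMTypeGalois.exists_isPrimitive
  PrimitiveCMTypeGalois.exists_isPrimitive_of_finrank_ne)
open Literature.NumberTheory.ComplexMultiplication (inducedCMType)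
open Summit.HodgeConjecture.HodgeConjecture.Ring2.Hypotheses (RosatiCompatible)

/-! ## The Hodge conjecture AT the CM power member: nondegenerate types (Pohlmann / Kubota / Yanai / Schappacher) -/

section HodgeAtMember

variable (K : Type) [Field K] [NumberField K] [IsCMField K] [IsGalois ℚ K]

/-- **HC at the census member, for a NONDEGENERATE type.** For `K` Galois CM, `[K:ℚ] > 2`, Deligne's presentation
`(b₀, R)`, a realisation `(B, ι, θ)` of a NONDEGENERATE CM type `Ψ` (`Pohlmann1968.IsNondegenerate`: Dodson rank
`[K:ℚ]/2 + 1`), every `p ≥ 1` and EVERY `δ`: the power `B^{2p}` carries a Weil-type `η`, a Rosati-compatible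
polarization class `h` of discriminant `δ`, AND the Hodge conjecture holds for `B^{2p}` (tree theorem
`IsNondegenerate.hodgeConjectureFor_pow`, unconditional: `Hdg = Div` on powers of a nondegenerate CM abelian variety);
consequently ALL of `W_E(B^{2p}) ⊗ ℂ` is algebraic — the conclusion of the cell `WeilClassesComponentCM R e₀ p δ` HOLDS
at this member. A CM anchor with HC IN THE KERNEL on every δ-row (census b03.6 (α)). [cite: Pohlmann1968, Thm. 1]
[cite: Deligne1982HodgeCycles, §5 (c) pp. 38–39] [cite: Gordon1999HodgeAVSurvey, Thm. 6.3] -/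
theorem exists_cmPower_hodgeConjectureFor_of_isNondegenerate (hK : 2 < Module.finrank ℚ K)
    {b₀ : 𝓞 K} (hb₀ : IsCMField.complexConj K (b₀ : K) = -(b₀ : K))
    (hsep : Function.Injective fun σ : K →+* ℂ => σ (b₀ : K))
    {R : Polynomial ℤ} {e₀ : ℕ} (he : Module.finrank ℚ K = 2 * e₀) (hRm : R.Monic) (hRdeg : R.natDegree = e₀)
    (hR : R.comp (X ^ 2) = minpoly ℤ b₀) (hirr : Irreducible (cmPolyQ R))
    (hroots : ∀ s : ℂ, Polynomial.eval₂ (Int.castRingHom ℂ) s R = 0 → s.im = 0 ∧ s.re < 0)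
    (haev : Polynomial.aeval (b₀ : K) (cmPolyQ R) = 0) (hdegQ : (cmPolyQ R).natDegree = Module.finrank ℚ K)
    [Fact (Irreducible (realPolyQ R))]
    {Ψ : CMType K} (hΨ : IsNondegenerate Ψ) {B : AbelianVariety ℂ} {ι : 𝓞 K →+* End B}
    {θ : K →+* Module.End ℂ (complexBetti B.X 1)} (hB : IsCMTypeRealisation Ψ B ι θ) {p : ℕ} (hp : 0 < p)
    (δ : cmNormResidueGroup R) :
    ∃ (η : (⨁ fun _ : Fin (2 * p) => B) ⟶ ⨁ fun _ : Fin (2 * p) => B)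
      (h : complexBetti (⨁ fun _ : Fin (2 * p) => B).X 2),
      IsOfCMType (⨁ fun _ : Fin (2 * p) => B) ∧ IsWeilTypeCM (⨁ fun _ : Fin (2 * p) => B) η R e₀ p ∧
      IsPolarizationClass (⨁ fun _ : Fin (2 * p) => B).dim (⨁ fun _ : Fin (2 * p) => B).X h ∧
      RosatiCompatible (⨁ fun _ : Fin (2 * p) => B) η h ∧
      HasWeilDiscriminantCM (⨁ fun _ : Fin (2 * p) => B) η R e₀ p h δ ∧
      HodgeConjectureFor (⨁ fun _ : Fin (2 * p) => B).dim (⨁ fun _ : Fin (2 * p) => B).X ∧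
      weilClassesField (⨁ fun _ : Fin (2 * p) => B) η (R.comp (X ^ 2)) (2 * p) ≤
        algebraicClasses (⨁ fun _ : Fin (2 * p) => B).X p := by
  obtain ⟨act, h, -, hcm, hW, hpol, hros, hdisc⟩ :=
    exists_cmPower_hasWeilDiscriminantCM K hK hb₀ hsep he hRm hRdeg hR hirr hroots haev hdegQ hB hp δ
  have hHC : HodgeConjectureFor (⨁ fun _ : Fin (2 * p) => B).dim (⨁ fun _ : Fin (2 * p) => B).X :=
    hΨ.hodgeConjectureFor_pow hB (2 * p)
  exact ⟨_, h, hcm, hW, hpol, hros, hdisc, hHC, hW.weilClassesField_le_algebraicClasses_of_hodgeConjectureFor hHC⟩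

/-- **Supply of nondegenerate types, degree `2ℓ` with `ℓ` an ODD prime** (Schappacher: a Galois CM field of degree
`∉ {4, 8}` has a primitive type; Yanai: primitive of prime half-degree ⟹ nondegenerate). Hence for such `K`, Deligne's
presentation `(b₀, R)`, every `p ≥ 1` and EVERY `δ`: a CM member of the δ-cell at which the Hodge conjecture HOLDS
and all of `W_E ⊗ ℂ` is algebraic. [cite: Schmidt1984CMArithmetik, Kap. II Satz 1.6] [cite: Yanai1985, §4 Theorem]
[cite: Pohlmann1968, Thm. 1] -/
theorem exists_cmMember_hodgeConjectureFor_of_finrank_eq_two_mul_prime {ℓ : ℕ} (hℓ : ℓ.Prime) (hℓ2 : ℓ ≠ 2)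
    (hKℓ : Module.finrank ℚ K = 2 * ℓ)
    {b₀ : 𝓞 K} (hb₀ : IsCMField.complexConj K (b₀ : K) = -(b₀ : K))
    (hsep : Function.Injective fun σ : K →+* ℂ => σ (b₀ : K))
    {R : Polynomial ℤ} {e₀ : ℕ} (he : Module.finrank ℚ K = 2 * e₀) (hRm : R.Monic) (hRdeg : R.natDegree = e₀)
    (hR : R.comp (X ^ 2) = minpoly ℤ b₀) (hirr : Irreducible (cmPolyQ R))
    (hroots : ∀ s : ℂ, Polynomial.eval₂ (Int.castRingHom ℂ) s R = 0 → s.im = 0 ∧ s.re < 0)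
    (haev : Polynomial.aeval (b₀ : K) (cmPolyQ R) = 0) (hdegQ : (cmPolyQ R).natDegree = Module.finrank ℚ K)
    [Fact (Irreducible (realPolyQ R))] {p : ℕ} (hp : 0 < p) (δ : cmNormResidueGroup R) :
    ∃ (A : AbelianVariety ℂ) (η : A ⟶ A) (h : complexBetti A.X 2),
      IsOfCMType A ∧ IsWeilTypeCM A η R e₀ p ∧ IsPolarizationClass A.dim A.X h ∧ RosatiCompatible A η h ∧
      HasWeilDiscriminantCM A η R e₀ p h δ ∧ HodgeConjectureFor A.dim A.X ∧
      weilClassesField A η (R.comp (X ^ 2)) (2 * p) ≤ algebraicClasses A.X p := by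
  have h4 : Module.finrank ℚ K ≠ 4 := by rw [hKℓ]; omega
  have h8 : Module.finrank ℚ K ≠ 8 := by
    rw [hKℓ]; intro h8
    have : ℓ = 4 := by omega
    subst this
    exact absurd hℓ (by decide)
  obtain ⟨Θ, hΘ⟩ := PrimitiveCMTypeGalois.exists_isPrimitive_of_finrank_ne (K := K) h4 h8
  obtain ⟨φ₀⟩ : Nonempty (K →+* ℂ) := inferInstance
  have hnd : IsNondegenerate Θ := isNondegenerate_of_isPrimitive_of_prime hℓ hKℓ φ₀ (hΘ φ₀)
  obtain ⟨B, ι, θ, hB⟩ := exists_isCMTypeRealisation Θ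
  obtain ⟨η, h, hcm, hW, hpol, hros, hdisc, hHC, halg⟩ :=
    exists_cmPower_hodgeConjectureFor_of_isNondegenerate K (by rw [hKℓ]; have := hℓ.two_le; omega) hb₀ hsep he hRm
      hRdeg hR hirr hroots haev hdegQ hnd hB hp δ
  exact ⟨_, η, h, hcm, hW, hpol, hros, hdisc, hHC, halg⟩

/-- **Every ABELIAN Galois CM field with `Gal(K/ℚ) ≄ V₄`** (Schmidt Kap. III Satz 2.1 in the tree:
`Pohlmann1968.AbelianCMFieldExistence.exists_isNondegenerate` — a nondegenerate type exists iff the group is not the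
Klein four-group): for
Deligne's presentation `(b₀, R)`, every `p ≥ 1` and EVERY `δ`, the δ-cell `(E, 2p, δ)` contains the power `B^{2p}` of a
SIMPLE CM abelian variety `B` of dimension `e₀` (Kubota: nondegenerate ⟹ primitive ⟹ simple) with a Weil-type `η`, a
Rosati-compatible polarization class of discriminant `δ`, the Hodge conjecture for `B^{2p}` (kernel, unconditional) and
`W_E(B^{2p}) ⊗ ℂ` algebraic. Covers every cyclotomic field `ℚ(ζ_N)` (`φ(N) > 2`, `≠` biquadratic) and the cyclic census
fields. [cite: Schmidt1984CMArithmetik, Kap. III Satz 2.1] [cite: Pohlmann1968, Thm. 1] [cite: Kubota1965, §2]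
[cite: Deligne1982HodgeCycles, §5 (c) pp. 38–39] -/
theorem exists_simplePower_hodgeConjectureFor_of_not_isKleinFour [IsMulCommutative (K ≃ₐ[ℚ] K)]
    (hV : ¬ IsKleinFour (K ≃ₐ[ℚ] K)) (hK : 2 < Module.finrank ℚ K)
    {b₀ : 𝓞 K} (hb₀ : IsCMField.complexConj K (b₀ : K) = -(b₀ : K))
    (hsep : Function.Injective fun σ : K →+* ℂ => σ (b₀ : K))
    {R : Polynomial ℤ} {e₀ : ℕ} (he : Module.finrank ℚ K = 2 * e₀) (hRm : R.Monic) (hRdeg : R.natDegree = e₀)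
    (hR : R.comp (X ^ 2) = minpoly ℤ b₀) (hirr : Irreducible (cmPolyQ R))
    (hroots : ∀ s : ℂ, Polynomial.eval₂ (Int.castRingHom ℂ) s R = 0 → s.im = 0 ∧ s.re < 0)
    (haev : Polynomial.aeval (b₀ : K) (cmPolyQ R) = 0) (hdegQ : (cmPolyQ R).natDegree = Module.finrank ℚ K)
    [Fact (Irreducible (realPolyQ R))] {p : ℕ} (hp : 0 < p) (δ : cmNormResidueGroup R) :
    ∃ (B : AbelianVariety ℂ) (η : (⨁ fun _ : Fin (2 * p) => B) ⟶ ⨁ fun _ : Fin (2 * p) => B)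
      (h : complexBetti (⨁ fun _ : Fin (2 * p) => B).X 2),
      B.IsSimple ∧ B.dim = e₀ ∧ IsOfCMType B ∧
      IsOfCMType (⨁ fun _ : Fin (2 * p) => B) ∧ IsWeilTypeCM (⨁ fun _ : Fin (2 * p) => B) η R e₀ p ∧
      IsPolarizationClass (⨁ fun _ : Fin (2 * p) => B).dim (⨁ fun _ : Fin (2 * p) => B).X h ∧
      RosatiCompatible (⨁ fun _ : Fin (2 * p) => B) η h ∧
      HasWeilDiscriminantCM (⨁ fun _ : Fin (2 * p) => B) η R e₀ p h δ ∧
      HodgeConjectureFor (⨁ fun _ : Fin (2 * p) => B).dim (⨁ fun _ : Fin (2 * p) => B).X ∧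
      weilClassesField (⨁ fun _ : Fin (2 * p) => B) η (R.comp (X ^ 2)) (2 * p) ≤
        algebraicClasses (⨁ fun _ : Fin (2 * p) => B).X p := by
  obtain ⟨Θ, hnd⟩ := Pohlmann1968.AbelianCMFieldExistence.exists_isNondegenerate (K := K) hV
  obtain ⟨B, ι, θ, hB⟩ := exists_isCMTypeRealisation Θ
  obtain ⟨hs, hd, -⟩ := Pohlmann1968.AbelianCMFieldExistence.isSimple_and_hodgeConjectureFor_pow_of_isNondegenerate hnd hB
  obtain ⟨η, h, hcm, hW, hpol, hros, hdisc, hHC, halg⟩ :=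
    exists_cmPower_hodgeConjectureFor_of_isNondegenerate K hK hb₀ hsep he hRm hRdeg hR hirr hroots haev hdegQ hnd hB
      hp δ
  refine ⟨B, η, h, hs, ?_, hB.isOfCMType, hcm, hW, hpol, hros, hdisc, hHC, halg⟩
  rw [hd, he, Nat.mul_div_cancel_left _ two_pos]

/-- **Every CYCLIC Galois CM field** (`IsKleinFour.not_isCyclic`, `IsCyclic.isMulCommutative`; no separate commutativity
instance needed): the same conclusion — on EVERY δ-row the power `B^{2p}` of a SIMPLE CM abelian variety with a
Rosati-compatible polarization class of discriminant `δ`, the Hodge conjecture for it, and `W_E ⊗ ℂ` algebraic.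
[cite: Schmidt1984CMArithmetik, Kap. III Satz 2.1] [cite: Pohlmann1968, Thm. 1]
[cite: Deligne1982HodgeCycles, §5 (c) pp. 38–39] -/
theorem exists_simplePower_hodgeConjectureFor_of_isCyclic (hc : IsCyclic (K ≃ₐ[ℚ] K)) (hK : 2 < Module.finrank ℚ K)
    {b₀ : 𝓞 K} (hb₀ : IsCMField.complexConj K (b₀ : K) = -(b₀ : K))
    (hsep : Function.Injective fun σ : K →+* ℂ => σ (b₀ : K))
    {R : Polynomial ℤ} {e₀ : ℕ} (he : Module.finrank ℚ K = 2 * e₀) (hRm : R.Monic) (hRdeg : R.natDegree = e₀)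
    (hR : R.comp (X ^ 2) = minpoly ℤ b₀) (hirr : Irreducible (cmPolyQ R))
    (hroots : ∀ s : ℂ, Polynomial.eval₂ (Int.castRingHom ℂ) s R = 0 → s.im = 0 ∧ s.re < 0)
    (haev : Polynomial.aeval (b₀ : K) (cmPolyQ R) = 0) (hdegQ : (cmPolyQ R).natDegree = Module.finrank ℚ K)
    [Fact (Irreducible (realPolyQ R))] {p : ℕ} (hp : 0 < p) (δ : cmNormResidueGroup R) :
    ∃ (B : AbelianVariety ℂ) (η : (⨁ fun _ : Fin (2 * p) => B) ⟶ ⨁ fun _ : Fin (2 * p) => B)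
      (h : complexBetti (⨁ fun _ : Fin (2 * p) => B).X 2),
      B.IsSimple ∧ B.dim = e₀ ∧ IsOfCMType B ∧
      IsOfCMType (⨁ fun _ : Fin (2 * p) => B) ∧ IsWeilTypeCM (⨁ fun _ : Fin (2 * p) => B) η R e₀ p ∧
      IsPolarizationClass (⨁ fun _ : Fin (2 * p) => B).dim (⨁ fun _ : Fin (2 * p) => B).X h ∧
      RosatiCompatible (⨁ fun _ : Fin (2 * p) => B) η h ∧
      HasWeilDiscriminantCM (⨁ fun _ : Fin (2 * p) => B) η R e₀ p h δ ∧
      HodgeConjectureFor (⨁ fun _ : Fin (2 * p) => B).dim (⨁ fun _ : Fin (2 * p) => B).X ∧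
      weilClassesField (⨁ fun _ : Fin (2 * p) => B) η (R.comp (X ^ 2)) (2 * p) ≤
        algebraicClasses (⨁ fun _ : Fin (2 * p) => B).X p := by
  haveI : IsMulCommutative (K ≃ₐ[ℚ] K) := hc.isMulCommutative
  have hV : ¬ IsKleinFour (K ≃ₐ[ℚ] K) := fun hK4 => by
    haveI := hK4
    exact IsKleinFour.not_isCyclic hc
  exact exists_simplePower_hodgeConjectureFor_of_not_isKleinFour K hV hK hb₀ hsep he hRm hRdeg hR hirr hroots haev hdegQ
    hp δ

/-- **The census rows of a CYCLIC QUARTIC field (`ℚ(ζ₅)`, `ℚ(√-(2+√2))`): HC at a CM eightfold on EVERY row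
`W8.E.δ`** — `B⁴ = B² × (B^ρ)²`, `B` a SIMPLE CM abelian SURFACE with CM by `𝓞_K`, with a Weil-type `(2,2;2,2)` datum,
a Rosati-compatible polarization class of discriminant `δ`, the Hodge conjecture for `B⁴` (kernel, unconditional:
Pohlmann / Yanai prime dimension `2`), and `W_E(B⁴) ⊗ ℂ ⊂ H⁴` algebraic: census b03.6 (α) in the kernel, every `δ`.
[cite: Pohlmann1968, Thm. 1] [cite: Yanai1985, §4 Theorem] [cite: Deligne1982HodgeCycles, §5 (c) pp. 38–39] -/
theorem exists_cmEightfold_hodgeConjectureFor_of_isCyclic_four (hc : IsCyclic (K ≃ₐ[ℚ] K))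
    (h4 : Module.finrank ℚ K = 4)
    {b₀ : 𝓞 K} (hb₀ : IsCMField.complexConj K (b₀ : K) = -(b₀ : K))
    (hsep : Function.Injective fun σ : K →+* ℂ => σ (b₀ : K))
    {R : Polynomial ℤ} {e₀ : ℕ} (he : Module.finrank ℚ K = 2 * e₀) (hRm : R.Monic) (hRdeg : R.natDegree = e₀)
    (hR : R.comp (X ^ 2) = minpoly ℤ b₀) (hirr : Irreducible (cmPolyQ R))
    (hroots : ∀ s : ℂ, Polynomial.eval₂ (Int.castRingHom ℂ) s R = 0 → s.im = 0 ∧ s.re < 0)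
    (haev : Polynomial.aeval (b₀ : K) (cmPolyQ R) = 0) (hdegQ : (cmPolyQ R).natDegree = Module.finrank ℚ K)
    [Fact (Irreducible (realPolyQ R))] (δ : cmNormResidueGroup R) :
    ∃ (A : AbelianVariety ℂ) (η : A ⟶ A) (h : complexBetti A.X 2) (B : AbelianVariety ℂ),
      Nonempty (A ≅ ⨁ fun _ : Fin 4 => B) ∧ B.IsSimple ∧ B.dim = 2 ∧ IsOfCMType B ∧ A.dim = 8 ∧ IsOfCMType A ∧
      IsWeilTypeCM A η R 2 2 ∧ IsPolarizationClass A.dim A.X h ∧ RosatiCompatible A η h ∧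
      HasWeilDiscriminantCM A η R 2 2 h δ ∧ HodgeConjectureFor A.dim A.X ∧
      weilClassesField A η (R.comp (X ^ 2)) (2 * 2) ≤ algebraicClasses A.X 2 := by
  have he₀ : e₀ = 2 := by omega
  subst he₀
  obtain ⟨B, η, h, hs, hd, hBcm, hcm, hW, hpol, hros, hdisc, hHC, halg⟩ :=
    exists_simplePower_hodgeConjectureFor_of_isCyclic K hc (by omega) hb₀ hsep he hRm hRdeg hR hirr hroots haev hdegQ
      two_pos δ
  exact ⟨_, η, h, B, ⟨Iso.refl _⟩, hs, hd, hBcm, by rw [hW.dim_eq]; rfl, hcm, hW, hpol, hros, hdisc, hHC, halg⟩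

end HodgeAtMember

/-! ## Induced types: Galois CM fields containing an imaginary quadratic subfield (the biquadratic census fields) -/

section Induced

variable (K : Type) [Field K] [NumberField K] [IsCMField K] [IsGalois ℚ K]
variable {K₁ : Type} [Field K₁] [NumberField K₁] [IsCMField K₁] [Algebra K₁ K]

omit [IsCMField K] [IsGalois ℚ K] in
/-- **`Hdg = Div` on every power ⟹ HC on every power, for a realisation of a type INDUCED from a nondegenerate type
of a CM subfield** (Hazama's criterion in the tree: `IsNondegenerate.hodgeClassSpan_pow_eq_divisorClassesSpan_inducedCMType`,
then Lefschetz (1,1) and products on the abelian variety, as in `IsNondegenerate.hodgeConjectureFor_pow`).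
[cite: Gordon1999HodgeAVSurvey, Thm. 6.4 and §9.3] [cite: Pohlmann1968, Thm. 1] -/
theorem hodgeConjectureFor_pow_of_inducedCMType {Φ₁ : CMType K₁} {Φ : CMType K}
    (hΦ : inducedCMType (algebraMap K₁ K) Φ₁ = Φ) (hΦ₁ : IsNondegenerate Φ₁)
    {B : AbelianVariety ℂ} {ι : 𝓞 K →+* End B} {θ : K →+* Module.End ℂ (complexBetti B.X 1)}
    (hB : IsCMTypeRealisation Φ B ι θ) (n : ℕ) :
    HodgeConjectureFor (⨁ fun _ : Fin n => B).dim (⨁ fun _ : Fin n => B).X := by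
  refine ⟨nonempty_hodgeModel_holds (Motives.AbelianVariety.isSmoothProjective_holds (A := ⨁ fun _ : Fin n => B)),
    fun m c hc hmm => ?_⟩
  refine AbelianVariety.divisorClassesSpan_le_algebraicClasses (⨁ fun _ : Fin n => B)
    (fun b hb hb' => lefschetzOneOne_rational_holds
      (Motives.AbelianVariety.isSmoothProjective_holds (A := ⨁ fun _ : Fin n => B)) b hb hb') m ?_
  rw [← hΦ₁.hodgeClassSpan_pow_eq_divisorClassesSpan_inducedCMType hΦ hB n m]
  exact Submodule.subset_span ⟨hc, hmm⟩

/-- **HC at the census member for an INDUCED type** (census b03.6 (β) in the kernel). For `K` Galois CM, `[K:ℚ] > 2`,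
Deligne's presentation `(b₀, R)`, a CM subfield `K₁ ⊆ K` with a NONDEGENERATE type `Φ₁` and `(B, ι, θ)` realising the
induced type `Φ = Ind Φ₁` (`B ~ A₁^{[K:K₁]}`, not simple), every `p ≥ 1` and EVERY `δ`: the power `B^{2p}` carries a
Weil-type `η`, a Rosati-compatible polarization class of discriminant `δ`, the Hodge conjecture (kernel, unconditional:
Hazama / Pohlmann for induced types) and `W_E(B^{2p}) ⊗ ℂ` algebraic. [cite: Gordon1999HodgeAVSurvey, Thm. 6.4 and §9.3]
[cite: Deligne1982HodgeCycles, §5 (c) pp. 38–39] -/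
theorem exists_cmPower_hodgeConjectureFor_of_inducedCMType (hK : 2 < Module.finrank ℚ K)
    {b₀ : 𝓞 K} (hb₀ : IsCMField.complexConj K (b₀ : K) = -(b₀ : K))
    (hsep : Function.Injective fun σ : K →+* ℂ => σ (b₀ : K))
    {R : Polynomial ℤ} {e₀ : ℕ} (he : Module.finrank ℚ K = 2 * e₀) (hRm : R.Monic) (hRdeg : R.natDegree = e₀)
    (hR : R.comp (X ^ 2) = minpoly ℤ b₀) (hirr : Irreducible (cmPolyQ R))
    (hroots : ∀ s : ℂ, Polynomial.eval₂ (Int.castRingHom ℂ) s R = 0 → s.im = 0 ∧ s.re < 0)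
    (haev : Polynomial.aeval (b₀ : K) (cmPolyQ R) = 0) (hdegQ : (cmPolyQ R).natDegree = Module.finrank ℚ K)
    [Fact (Irreducible (realPolyQ R))]
    {Φ₁ : CMType K₁} {Φ : CMType K} (hΦ : inducedCMType (algebraMap K₁ K) Φ₁ = Φ) (hΦ₁ : IsNondegenerate Φ₁)
    {B : AbelianVariety ℂ} {ι : 𝓞 K →+* End B} {θ : K →+* Module.End ℂ (complexBetti B.X 1)}
    (hB : IsCMTypeRealisation Φ B ι θ) {p : ℕ} (hp : 0 < p) (δ : cmNormResidueGroup R) :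
    ∃ (η : (⨁ fun _ : Fin (2 * p) => B) ⟶ ⨁ fun _ : Fin (2 * p) => B)
      (h : complexBetti (⨁ fun _ : Fin (2 * p) => B).X 2),
      IsOfCMType (⨁ fun _ : Fin (2 * p) => B) ∧ IsWeilTypeCM (⨁ fun _ : Fin (2 * p) => B) η R e₀ p ∧
      IsPolarizationClass (⨁ fun _ : Fin (2 * p) => B).dim (⨁ fun _ : Fin (2 * p) => B).X h ∧
      RosatiCompatible (⨁ fun _ : Fin (2 * p) => B) η h ∧
      HasWeilDiscriminantCM (⨁ fun _ : Fin (2 * p) => B) η R e₀ p h δ ∧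
      HodgeConjectureFor (⨁ fun _ : Fin (2 * p) => B).dim (⨁ fun _ : Fin (2 * p) => B).X ∧
      weilClassesField (⨁ fun _ : Fin (2 * p) => B) η (R.comp (X ^ 2)) (2 * p) ≤
        algebraicClasses (⨁ fun _ : Fin (2 * p) => B).X p := by
  obtain ⟨act, h, -, hcm, hW, hpol, hros, hdisc⟩ :=
    exists_cmPower_hasWeilDiscriminantCM K hK hb₀ hsep he hRm hRdeg hR hirr hroots haev hdegQ hB hp δ
  have hHC := hodgeConjectureFor_pow_of_inducedCMType K hΦ hΦ₁ hB (2 * p)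
  exact ⟨_, h, hcm, hW, hpol, hros, hdisc, hHC, hW.weilClassesField_le_algebraicClasses_of_hodgeConjectureFor hHC⟩

/-- **Every Galois CM field containing an IMAGINARY QUADRATIC subfield `K₁`** (every CM type of `K₁` is
nondegenerate, `Pohlmann1968.isNondegenerate_of_finrank_eq_two`; its induced type is realised by Shimura §6.2 Thm. 3):
for Deligne's presentation `(b₀, R)`, every `p ≥ 1` and EVERY `δ`, the δ-cell `(E, 2p, δ)` contains a CM member
(`B^{2p}`, `B ~ C₁^{e₀}`, `C₁` an elliptic curve with CM by `K₁`) at which the Hodge conjecture HOLDS and `W_E ⊗ ℂ` is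
algebraic. Covers the biquadratic census fields `ℚ(ζ₈) ⊃ ℚ(i)`, `ℚ(ζ₁₂) ⊃ ℚ(i)`, `ℚ(√-3,√5) ⊃ ℚ(√-3)`,
`ℚ(i,√5) ⊃ ℚ(i)` — census b03.6 (β). [cite: Kubota1965, §2] [cite: Gordon1999HodgeAVSurvey, Thm. 6.4 and §9.3]
[cite: Shimura1998, §6.2 Theorem 3] [cite: Deligne1982HodgeCycles, §5 (c) pp. 38–39] -/
theorem exists_cmMember_hodgeConjectureFor_of_quadratic_subfield (h2 : Module.finrank ℚ K₁ = 2)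
    (hK : 2 < Module.finrank ℚ K)
    {b₀ : 𝓞 K} (hb₀ : IsCMField.complexConj K (b₀ : K) = -(b₀ : K))
    (hsep : Function.Injective fun σ : K →+* ℂ => σ (b₀ : K))
    {R : Polynomial ℤ} {e₀ : ℕ} (he : Module.finrank ℚ K = 2 * e₀) (hRm : R.Monic) (hRdeg : R.natDegree = e₀)
    (hR : R.comp (X ^ 2) = minpoly ℤ b₀) (hirr : Irreducible (cmPolyQ R))
    (hroots : ∀ s : ℂ, Polynomial.eval₂ (Int.castRingHom ℂ) s R = 0 → s.im = 0 ∧ s.re < 0)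
    (haev : Polynomial.aeval (b₀ : K) (cmPolyQ R) = 0) (hdegQ : (cmPolyQ R).natDegree = Module.finrank ℚ K)
    [Fact (Irreducible (realPolyQ R))] {p : ℕ} (hp : 0 < p) (δ : cmNormResidueGroup R) :
    ∃ (A : AbelianVariety ℂ) (η : A ⟶ A) (h : complexBetti A.X 2),
      IsOfCMType A ∧ IsWeilTypeCM A η R e₀ p ∧ IsPolarizationClass A.dim A.X h ∧ RosatiCompatible A η h ∧
      HasWeilDiscriminantCM A η R e₀ p h δ ∧ HodgeConjectureFor A.dim A.X ∧
      weilClassesField A η (R.comp (X ^ 2)) (2 * p) ≤ algebraicClasses A.X p := by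
  obtain ⟨Φ₁⟩ := nonempty_cmType_of_isCMField (K := K₁)
  have hΦ₁ : IsNondegenerate Φ₁ := Pohlmann1968.isNondegenerate_of_finrank_eq_two Φ₁ h2
  obtain ⟨B, ι, θ, hB⟩ := exists_isCMTypeRealisation (inducedCMType (algebraMap K₁ K) Φ₁)
  obtain ⟨η, h, hcm, hW, hpol, hros, hdisc, hHC, halg⟩ :=
    exists_cmPower_hodgeConjectureFor_of_inducedCMType K hK hb₀ hsep he hRm hRdeg hR hirr hroots haev hdegQ rfl hΦ₁ hB
      hp δ
  exact ⟨_, η, h, hcm, hW, hpol, hros, hdisc, hHC, halg⟩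

/-- **The census rows of a quartic Galois CM field containing an imaginary quadratic field (the four BIQUADRATIC
census fields): HC at a CM eightfold on EVERY row `W8.E.δ`** — `B⁴ = B² × (B^ρ)²` with `B ~ C₁²` a CM abelian surface of
induced type, a Weil-type `(2,2;2,2)` datum, a Rosati-compatible polarization class of discriminant `δ`, the Hodge
conjecture for `B⁴` (kernel, unconditional) and `W_E(B⁴) ⊗ ℂ ⊂ H⁴` algebraic: census b03.6 (β) in the kernel, every
`δ`. Together with `exists_cmEightfold_hodgeConjectureFor_of_isCyclic_four`: EVERY quartic Galois CM field.
[cite: Kubota1965, §2] [cite: Gordon1999HodgeAVSurvey, Thm. 6.4] [cite: Deligne1982HodgeCycles, §5 (c) pp. 38–39] -/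
theorem exists_cmEightfold_hodgeConjectureFor_of_quadratic_subfield_four (h2 : Module.finrank ℚ K₁ = 2)
    (h4 : Module.finrank ℚ K = 4)
    {b₀ : 𝓞 K} (hb₀ : IsCMField.complexConj K (b₀ : K) = -(b₀ : K))
    (hsep : Function.Injective fun σ : K →+* ℂ => σ (b₀ : K))
    {R : Polynomial ℤ} {e₀ : ℕ} (he : Module.finrank ℚ K = 2 * e₀) (hRm : R.Monic) (hRdeg : R.natDegree = e₀)
    (hR : R.comp (X ^ 2) = minpoly ℤ b₀) (hirr : Irreducible (cmPolyQ R))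
    (hroots : ∀ s : ℂ, Polynomial.eval₂ (Int.castRingHom ℂ) s R = 0 → s.im = 0 ∧ s.re < 0)
    (haev : Polynomial.aeval (b₀ : K) (cmPolyQ R) = 0) (hdegQ : (cmPolyQ R).natDegree = Module.finrank ℚ K)
    [Fact (Irreducible (realPolyQ R))] (δ : cmNormResidueGroup R) :
    ∃ (A : AbelianVariety ℂ) (η : A ⟶ A) (h : complexBetti A.X 2),
      A.dim = 8 ∧ IsOfCMType A ∧ IsWeilTypeCM A η R 2 2 ∧ IsPolarizationClass A.dim A.X h ∧ RosatiCompatible A η h ∧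
      HasWeilDiscriminantCM A η R 2 2 h δ ∧ HodgeConjectureFor A.dim A.X ∧
      weilClassesField A η (R.comp (X ^ 2)) (2 * 2) ≤ algebraicClasses A.X 2 := by
  have he₀ : e₀ = 2 := by omega
  subst he₀
  obtain ⟨A, η, h, hcm, hW, hpol, hros, hdisc, hHC, halg⟩ :=
    exists_cmMember_hodgeConjectureFor_of_quadratic_subfield K h2 (by omega) hb₀ hsep he hRm hRdeg hR hirr hroots haev
      hdegQ two_pos δ
  exact ⟨A, η, h, by rw [hW.dim_eq]; rfl, hcm, hW, hpol, hros, hdisc, hHC, halg⟩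

end Induced

end Summit.HodgeConjecture.HodgeConjecture.Ring2.WeilCoverageCM

end
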